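import Mathlib
import HarnessLib
import Literature.MathematicalPhysics.StatisticalMechanics.RenormalisationMapSplit
import Literature.MathematicalPhysics.StatisticalMechanics.ReblockingIndexSplit
import Literature.MathematicalPhysics.StatisticalMechanics.FirstOrderCancellationBlock

/-!
# `S(H,K)(U) − C_kK(U)` as an explicit sum of second-order terms ([ABKM19] Theorem 6.8 / Ch. 9.1)

The identification of the linearisation of the renormalisation map at the origin,
`D S(0,0)(Ḣ, K̇) = (0, C_k K̇)` ([ABKM19] Theorem 6.8), in the exact (non-infinitesimal) form the crux
line's Lipschitz estimate needs: for a non-empty `(k+1)`-polymer `U`,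
`K_{k+1}(U) − C_kK(U) = Σ_{blocks} + Σ_{large connected} + Σ_{disconnected} + Σ_{∅≠X₁⊊X}` of terms each of
which is manifestly of second order in `(H, K)`:

* over the single `k`-blocks `B` with `B̄ = U` (`blockPartIndex`):
  `(p_B − 1)·blockTerm(B) + p_B·[D_B(H) + (e^{−A_kH(B)}−1)(1−e^{−u_B}) − (e^{−u_B}−1+u_B)] + p_B·R[rest(B)]`
  (`FirstOrderCancellationBlock.firstOrder_block_identity`);
* over the connected `X` with `≥ 2` blocks and `π(X) = U` (`largePartIndex`):
  `(p_X − 1)·R K(X) + p_X·[R(e^{−H}−1)^X + R[rest(X)] + (1−e^{−H̃})^X]`;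
* over the disconnected `X` with `π(X) = U`: `p_X·[R P₂(X) + (1−e^{−H̃})^X]`;
* the terms with `∅ ≠ X₁ ⊊ X` of `RenormalisationMapSplit.nextKStep_eq_split`;

where `p_X = (e^{−H̃})^{U∖X}(e^{H̃})^{X∖U}`, `H̃ = A_kH + B_kK`, `rest(X) = Σ_{∅≠Y⊊X}(e^{−H}−1)^{X∖Y}K(Y)`.
The inputs `R[P₂(X)] = RK(X) + R(e^{−H}−1)^X + R[rest(X)]` (integrability) and the hypotheses of
`nextH_eq` are taken as hypotheses; for the torus data they are
`RenormalisationMapP2FluctSplit.fluct_polyP2_eq_add_add_rest_abkm` and the box facts of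
`NextHamiltonianBounds`.

* **`nextKStep_sub_opC_eq`** — the displayed identity.

Everything is proved; no named fact.

## References
* S. Adams, S. Buchholz, R. Kotecký, S. Müller, arXiv:1910.13564, Theorem 6.8 ((6.55)–(6.64)),
  Ch. 9.1, Ch. 10.1 ((10.1)–(10.3)) [AdamsBuchholzKoteckyMuller2019].
-/

noncomputable section

namespace Literature.MathematicalPhysics.StatisticalMechanics.GradientRG

open scoped BigOperators Classical
open Finset MeasureTheory
open Literature.MathematicalPhysics.StatisticalMechanics.TorusPolymer
  (IsPolymer blocks polys bprod blockOf closure reblock mem_polys mem_blocks isPolymer_blockOf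
    blocks_blockOf bprod_blockOf subset_closure)
open Literature.Barriers.CriticalPhenomena.LongRangePhi4.Polymer (IsConn)

variable {d M : ℕ} [NeZero M]

/-- **`K_{k+1}(U) − C_kK(U)` as an explicit sum of second-order terms.**  Hypotheses: odd torus and
sides (`π` well behaved), `K(∅) = 1`, `U ≠ ∅`, the integrability of the `P₂(Z, φ+·)` (for
`nextKStep_eq_sum`), the split `R[P₂(X)] = RK(X) + R(e^{−H}−1)^X + R[rest(X)]` for the `π`-preimages of
`U`, the hypotheses of `nextH_eq` (`circulant 𝒞 ⪰ 0`, `B₀ ≠ ∅`, room), and the integrability of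
`e^{−H(B, φ+·)}` on the blocks of `U`.  See the module docstring for the four sums.
[cite: AdamsBuchholzKoteckyMuller2019, Theorem 6.8 / Ch. 9.1] -/
theorem nextKStep_sub_opC_eq (D : StepData d M) (hMo : Odd M) (hs : Odd D.s) (hL : Odd D.L)
    (hC : (Matrix.circulant D.𝒞).PosSemidef) (hB₀ : D.B₀.card ≠ 0)
    (hroom : ∀ x ∈ D.B₀, HasRoom D.c₀ x (d / 2 + 1))
    (H : RelevantHamiltonian ℂ d) (K : Finset (Fin d → ZMod M) → ((Fin d → ZMod M) → ℝ) → ℂ)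
    (hK0 : ∀ φ, K ∅ φ = 1) {U : Finset (Fin d → ZMod M)} (hU : U.Nonempty) (φ : (Fin d → ZMod M) → ℝ)
    (hint : ∀ Z, IsPolymer D.s Z → Integrable (fun ξ => polyP2 D.s H K Z (φ + ξ)) (stepMeasure D.𝒞))
    (hsplit : ∀ X ∈ (polys D.s univ).filter (fun X => reblock D.s (D.L * D.s) X = U),
      fluct D.𝒞 (polyP2 D.s H K X) φ =
        fluct D.𝒞 (K X) φ + fluct D.𝒞 (fun ψ => bprod D.s (fun B => expNegH H B ψ - 1) X) φ +
          fluct D.𝒞 (fun ψ => ∑ Y ∈ ((polys D.s X).erase X).erase ∅,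
            bprod D.s (fun B => expNegH H B ψ - 1) (X \ Y) * K Y ψ) φ)
    (hI : ∀ B ∈ blockPartIndex D U, Integrable (fun ξ => expNegH H B (φ + ξ)) (stepMeasure D.𝒞)) :
    nextKStep D H K U φ - opC D K U φ =
      (∑ B ∈ blockPartIndex D U,
        ((bprod D.s (fun B' => expNegH (nextH D H K) B' φ) (U \ B) *
              bprod D.s (fun B' => expNegH (-(nextH D H K)) B' φ) (B \ U) - 1) * blockTerm D K B φ +
          bprod D.s (fun B' => expNegH (nextH D H K) B' φ) (U \ B) *
              bprod D.s (fun B' => expNegH (-(nextH D H K)) B' φ) (B \ U) *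
            (fluctDefect D.𝒞 H B φ +
              (expNegH (stepOpA (gradCov D.𝒞) H) B φ - 1) * (1 - Complex.exp (-(eval (opB D K) B φ))) -
              (Complex.exp (-(eval (opB D K) B φ)) - 1 + eval (opB D K) B φ)) +
          bprod D.s (fun B' => expNegH (nextH D H K) B' φ) (U \ B) *
              bprod D.s (fun B' => expNegH (-(nextH D H K)) B' φ) (B \ U) *
            fluct D.𝒞 (fun ψ => ∑ Y ∈ ((polys D.s B).erase B).erase ∅,
              bprod D.s (fun B' => expNegH H B' ψ - 1) (B \ Y) * K Y ψ) φ)) +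
      (∑ X ∈ largePartIndex D.s D.L U,
        ((bprod D.s (fun B' => expNegH (nextH D H K) B' φ) (U \ X) *
              bprod D.s (fun B' => expNegH (-(nextH D H K)) B' φ) (X \ U) - 1) * fluct D.𝒞 (K X) φ +
          bprod D.s (fun B' => expNegH (nextH D H K) B' φ) (U \ X) *
              bprod D.s (fun B' => expNegH (-(nextH D H K)) B' φ) (X \ U) *
            (fluct D.𝒞 (fun ψ => bprod D.s (fun B => expNegH H B ψ - 1) X) φ +
              fluct D.𝒞 (fun ψ => ∑ Y ∈ ((polys D.s X).erase X).erase ∅,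
                bprod D.s (fun B => expNegH H B ψ - 1) (X \ Y) * K Y ψ) φ +
              bprod D.s (fun B => 1 - expNegH (nextH D H K) B φ) X))) +
      (∑ X ∈ ((polys D.s univ).filter (fun X => reblock D.s (D.L * D.s) X = U)).filter (fun X => ¬ IsConn X),
        bprod D.s (fun B' => expNegH (nextH D H K) B' φ) (U \ X) *
            bprod D.s (fun B' => expNegH (-(nextH D H K)) B' φ) (X \ U) *
          (fluct D.𝒞 (polyP2 D.s H K X) φ + bprod D.s (fun B => 1 - expNegH (nextH D H K) B φ) X)) +
      ∑ X ∈ (polys D.s univ).filter (fun X => reblock D.s (D.L * D.s) X = U),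
        ∑ X₁ ∈ ((polys D.s X).erase X).erase ∅,
          bprod D.s (fun B => expNegH (nextH D H K) B φ) (U \ X) *
            bprod D.s (fun B => expNegH (-(nextH D H K)) B φ) (X \ U) *
            (bprod D.s (fun B => 1 - expNegH (nextH D H K) B φ) X₁ *
              fluct D.𝒞 (polyP2 D.s H K (X \ X₁)) φ) := by
  set 𝓧 := (polys D.s univ).filter (fun X => reblock D.s (D.L * D.s) X = U) with h𝓧
  -- abbreviations for the prefactor and the pieces
  set p : Finset (Fin d → ZMod M) → ℂ := fun X =>
    bprod D.s (fun B' => expNegH (nextH D H K) B' φ) (U \ X) *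
      bprod D.s (fun B' => expNegH (-(nextH D H K)) B' φ) (X \ U) with hp
  set J : Finset (Fin d → ZMod M) → ℂ := fun X => bprod D.s (fun B => 1 - expNegH (nextH D H K) B φ) X with hJ
  set RP : Finset (Fin d → ZMod M) → ℂ := fun X => fluct D.𝒞 (polyP2 D.s H K X) φ with hRP
  set RK : Finset (Fin d → ZMod M) → ℂ := fun X => fluct D.𝒞 (K X) φ with hRK
  set RE : Finset (Fin d → ZMod M) → ℂ := fun X =>
    fluct D.𝒞 (fun ψ => bprod D.s (fun B => expNegH H B ψ - 1) X) φ with hRE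
  set Rr : Finset (Fin d → ZMod M) → ℂ := fun X =>
    fluct D.𝒞 (fun ψ => ∑ Y ∈ ((polys D.s X).erase X).erase ∅,
      bprod D.s (fun B => expNegH H B ψ - 1) (X \ Y) * K Y ψ) φ with hRr
  -- the outer split and the three-way split of the first sum
  rw [nextKStep_eq_split D H K hK0 hU φ hint]
  have hthree := sum_filter_reblock_eq_three D hMo hs hL U (fun X => p X * (RP X + J X))
  -- blocks: `B = B_x ⊆ U`, the pieces on a single block, and the first-order cancellation
  have hblk : ∀ B ∈ blockPartIndex D U, p B * (RP B + J B) = blockTerm D K B φ +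
      ((p B - 1) * blockTerm D K B φ +
        p B * (fluctDefect D.𝒞 H B φ +
          (expNegH (stepOpA (gradCov D.𝒞) H) B φ - 1) * (1 - Complex.exp (-(eval (opB D K) B φ))) -
          (Complex.exp (-(eval (opB D K) B φ)) - 1 + eval (opB D K) B φ)) + p B * Rr B) := by
    intro B hB
    have hB𝓧 : B ∈ 𝓧 := by
      have : B ∈ 𝓧.filter (fun X => IsConn X ∧ (blocks D.s X).card = 1) := by
        rw [h𝓧, filter_reblock_isConn_card_eq_one D hMo hs hL U]; exact hB
      exact mem_of_mem_filter _ this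
    obtain ⟨hBb, hcl⟩ := mem_filter.1 hB
    obtain ⟨x, -, rfl⟩ := mem_blocks.1 hBb
    have hRPB : RP (blockOf D.s x) = RK (blockOf D.s x) +
        fluct D.𝒞 (fun ψ => expNegH H (blockOf D.s x) ψ - 1) φ + Rr (blockOf D.s x) := by
      have h := hsplit _ hB𝓧
      have hfun : (fun ψ => bprod D.s (fun B => expNegH H B ψ - 1) (blockOf D.s x)) =
          fun ψ => expNegH H (blockOf D.s x) ψ - 1 := by
        funext ψ; exact bprod_blockOf D.s _ x
      rw [hfun] at h
      exact h
    have hJB : J (blockOf D.s x) = 1 - expNegH (nextH D H K) (blockOf D.s x) φ := bprod_blockOf D.s _ x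
    rw [hRPB, hJB]
    have hfo := firstOrder_block_identity D hC hB₀ hroom H K (blockOf D.s x) φ (p (blockOf D.s x)) (hI _ hB)
    rw [blockTerm] at hfo ⊢
    linear_combination hfo
  -- large connected polymers
  have hlrg : ∀ X ∈ largePartIndex D.s D.L U, p X * (RP X + J X) = RK X +
      ((p X - 1) * RK X + p X * (RE X + Rr X + J X)) := by
    intro X hX
    have hX𝓧 : X ∈ 𝓧 := by
      have : X ∈ 𝓧.filter (fun X => IsConn X ∧ 2 ≤ (blocks D.s X).card) := by
        rw [h𝓧, filter_reblock_isConn_two_le D U]; exact hX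
      exact mem_of_mem_filter _ this
    rw [show RP X = RK X + RE X + Rr X from hsplit X hX𝓧]
    ring
  -- assemble
  rw [hthree, sum_congr rfl hblk, sum_add_distrib (f := fun B => blockTerm D K B φ),
    sum_congr rfl hlrg, sum_add_distrib (f := fun X => RK X)]
  unfold opC blockPart largePart
  simp only [hp, hJ, hRP, hRK, hRE, hRr, h𝓧]
  ring

end Literature.MathematicalPhysics.StatisticalMechanics.GradientRG

end
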